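import Mathlib
import Summits.Ventures.PercRepro2.RootCutTheorem

/-!
# Gluing at a 2-separator, I: the closure lemmas and the far-pattern tools (blind cell PercRepro2,
mine-2 g46, 2026-08-29; `conjectures/MINE-2.md` M2-95)

Two vertex sets `W`, `W'` meeting exactly in `{c, d}`, every open edge within one of them.  A
connection between two vertices of `W` runs inside `W`, or leaves `W` exactly through the far
identification of `c` with `d` — `c ↔ d` inside `W'` — (`conn_side2`); a connection from `r ∈ W` to
`u ∈ W' ∖ {c, d}` enters the far side at `c` or at `d` (`conn_cross2`).  Both are read off the two
side restrictions `withinRestr`, by the closure argument of `RootCutSupport.conn_side` with the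
closed set `reachW ∪ reachW'`.

The FAR PATTERN of a copy is the triple `(1[c ↔ d], 1[c ↔ u], 1[d ↔ u])` read on the far side
(`fp`); the realisable patterns are the five set partitions of `{c, d, u}` (`fp_ok`).  Tools for
the gluing identities of the sequel: the typed count of a finite sum of kernels
(`typedCount_sum`), the exact-pattern indicator and its sum (`sum_exact2`), the far-pattern kernel
`farK` of a pattern triple with its nonnegativity, its vanishing on unrealisable triples and its
copy symmetry (`farCount_swap12`, `farCount_swap23`, `farCount_swap13`, `farCount_cyc`,
`farCount_cyc'`).  Own work; standard axioms.
-/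

namespace Summit.Ventures.PercRepro2

open UnionCluster

namespace CovForm

namespace RootBridge

open OneTyped TypedA3 Untouched TypedFactor Separated

/-! ## The closure lemmas at a 2-separator -/

section Sides

open Classical

variable {V : Type*} {E : Type*} (ends : E → Sym2 V)

/-- The vertices reached from `r` inside `W`, directly or through the far identification of `c`
with `d`. -/
def reachW (W W' : Set V) (c d : V) (x : Config E) (r t : V) : Prop :=
  Conn ends (withinRestr ends W x) r t ∨
    (Conn ends (withinRestr ends W x) r c ∧ Conn ends (withinRestr ends W' x) c d ∧
      Conn ends (withinRestr ends W x) d t) ∨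
    (Conn ends (withinRestr ends W x) r d ∧ Conn ends (withinRestr ends W' x) c d ∧
      Conn ends (withinRestr ends W x) c t)

/-- The vertices of the far side reached from `r ∈ W`: through `c` or through `d`. -/
def reachW' (W W' : Set V) (c d : V) (x : Config E) (r t : V) : Prop :=
  (Conn ends (withinRestr ends W x) r c ∧ Conn ends (withinRestr ends W' x) c t) ∨
    (Conn ends (withinRestr ends W x) r d ∧ Conn ends (withinRestr ends W' x) d t)

/-- `reachW` is closed under steps inside `W`. -/
lemma reachW_trans {W W' : Set V} {c d : V} {x : Config E} {r t t' : V}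
    (h : reachW ends W W' c d x r t) (h' : Conn ends (withinRestr ends W x) t t') :
    reachW ends W W' c d x r t' := by
  unfold reachW at h ⊢
  rcases h with h | ⟨h1, h2, h3⟩ | ⟨h1, h2, h3⟩
  · exact Or.inl (conn_trans h h')
  · exact Or.inr (Or.inl ⟨h1, h2, conn_trans h3 h'⟩)
  · exact Or.inr (Or.inr ⟨h1, h2, conn_trans h3 h'⟩)

/-- `reachW'` is closed under steps inside `W'`. -/
lemma reachW'_trans {W W' : Set V} {c d : V} {x : Config E} {r t t' : V}
    (h : reachW' ends W W' c d x r t) (h' : Conn ends (withinRestr ends W' x) t t') :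
    reachW' ends W W' c d x r t' := by
  unfold reachW' at h ⊢
  rcases h with ⟨h1, h2⟩ | ⟨h1, h2⟩
  · exact Or.inl ⟨h1, conn_trans h2 h'⟩
  · exact Or.inr ⟨h1, conn_trans h2 h'⟩

/-- At `c` the two descriptions agree: `reachW → reachW'`. -/
lemma reachW'_of_reachW_c {W W' : Set V} {c d : V} {x : Config E} {r : V}
    (h : reachW ends W W' c d x r c) : reachW' ends W W' c d x r c := by
  unfold reachW at h
  unfold reachW'
  rcases h with h | ⟨h1, _, _⟩ | ⟨h1, h2, _⟩
  · exact Or.inl ⟨h, conn_refl _ _ _⟩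
  · exact Or.inl ⟨h1, conn_refl _ _ _⟩
  · exact Or.inr ⟨h1, conn_symm h2⟩

/-- At `d` the two descriptions agree: `reachW → reachW'`. -/
lemma reachW'_of_reachW_d {W W' : Set V} {c d : V} {x : Config E} {r : V}
    (h : reachW ends W W' c d x r d) : reachW' ends W W' c d x r d := by
  unfold reachW at h
  unfold reachW'
  rcases h with h | ⟨h1, h2, _⟩ | ⟨h1, _, _⟩
  · exact Or.inr ⟨h, conn_refl _ _ _⟩
  · exact Or.inl ⟨h1, h2⟩
  · exact Or.inr ⟨h1, conn_refl _ _ _⟩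

/-- At `c` the two descriptions agree: `reachW' → reachW`. -/
lemma reachW_of_reachW'_c {W W' : Set V} {c d : V} {x : Config E} {r : V}
    (h : reachW' ends W W' c d x r c) : reachW ends W W' c d x r c := by
  unfold reachW' at h
  unfold reachW
  rcases h with ⟨h1, _⟩ | ⟨h1, h2⟩
  · exact Or.inl h1
  · exact Or.inr (Or.inr ⟨h1, conn_symm h2, conn_refl _ _ _⟩)

/-- At `d` the two descriptions agree: `reachW' → reachW`. -/
lemma reachW_of_reachW'_d {W W' : Set V} {c d : V} {x : Config E} {r : V}
    (h : reachW' ends W W' c d x r d) : reachW ends W W' c d x r d := by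
  unfold reachW' at h
  unfold reachW
  rcases h with ⟨h1, h2⟩ | ⟨h1, _⟩
  · exact Or.inr (Or.inl ⟨h1, h2, conn_refl _ _ _⟩)
  · exact Or.inl h1

/-- **The closure argument at a 2-separator**: everything connected to `r ∈ W` is reached inside
`W` (through the far identification at most) or lies on the far side, entered at `c` or `d`. -/
theorem reach_of_conn {W W' : Set V} {c d : V} {x : Config E}
    (hx : ∀ e, x e = true → e ∈ within ends W ∨ e ∈ within ends W')
    (hcap : ∀ t, t ∈ W → t ∈ W' → t = c ∨ t = d) {r u : V} (hr : r ∈ W)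
    (h : Conn ends x r u) :
    (u ∈ W ∧ reachW ends W W' c d x r u) ∨ (u ∈ W' ∧ reachW' ends W W' c d x r u) := by
  refine mem_of_conn_of_closed (ends := ends) (ω := x)
    (S := {t | (t ∈ W ∧ reachW ends W W' c d x r t) ∨ (t ∈ W' ∧ reachW' ends W W' c d x r t)})
    ?_ (Or.inl ⟨hr, Or.inl (conn_refl _ _ _)⟩) h
  rintro t ht t' htt'
  obtain ⟨_, e, he, hends⟩ := openGraph_adj.1 htt'
  rcases hx e he with hw | hw'
  · have hmem := ends_mem_of_within ends hw hends
    have he' : withinRestr ends W x e = true := by simp [withinRestr, hw, he]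
    have hstep : Conn ends (withinRestr ends W x) t t' := conn_of_openAdj ⟨e, he', hends⟩
    have hA : reachW ends W W' c d x r t := by
      rcases ht with ⟨_, hA⟩ | ⟨htW', hB⟩
      · exact hA
      · rcases hcap t hmem.1 htW' with rfl | rfl
        · exact reachW_of_reachW'_c ends hB
        · exact reachW_of_reachW'_d ends hB
    exact Or.inl ⟨hmem.2, reachW_trans ends hA hstep⟩
  · have hmem := ends_mem_of_within ends hw' hends
    have he' : withinRestr ends W' x e = true := by simp [withinRestr, hw', he]
    have hstep : Conn ends (withinRestr ends W' x) t t' := conn_of_openAdj ⟨e, he', hends⟩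
    have hB : reachW' ends W W' c d x r t := by
      rcases ht with ⟨htW, hA⟩ | ⟨_, hB⟩
      · rcases hcap t htW hmem.1 with rfl | rfl
        · exact reachW'_of_reachW_c ends hA
        · exact reachW'_of_reachW_d ends hA
      · exact hB
    exact Or.inr ⟨hmem.2, reachW'_trans ends hB hstep⟩

/-- **Side closure at a 2-separator**: for `r, u ∈ W` the connection `r ↔ u` runs inside `W`, or
inside `W` up to `c` (resp. `d`), through the far identification `c ↔ d`, and inside `W` from `d`
(resp. `c`). -/
theorem conn_side2 {W W' : Set V} {c d : V} {x : Config E}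
    (hx : ∀ e, x e = true → e ∈ within ends W ∨ e ∈ within ends W')
    (hcap : ∀ t, t ∈ W → t ∈ W' → t = c ∨ t = d) {r u : V} (hr : r ∈ W) (hu : u ∈ W) :
    Conn ends x r u ↔ reachW ends W W' c d x r u := by
  constructor
  · intro h
    rcases reach_of_conn ends hx hcap hr h with ⟨_, hA⟩ | ⟨huW', hB⟩
    · exact hA
    · rcases hcap u hu huW' with rfl | rfl
      · exact reachW_of_reachW'_c ends hB
      · exact reachW_of_reachW'_d ends hB
  · intro h
    have hW := withinRestr_le ends W x
    have hW' := withinRestr_le ends W' x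
    unfold reachW at h
    rcases h with h | ⟨h1, h2, h3⟩ | ⟨h1, h2, h3⟩
    · exact conn_mono hW h
    · exact conn_trans (conn_mono hW h1) (conn_trans (conn_mono hW' h2) (conn_mono hW h3))
    · exact conn_trans (conn_mono hW h1)
        (conn_trans (conn_mono hW' (conn_symm h2)) (conn_mono hW h3))

/-- **Crossing a 2-separator**: a connection from `r ∈ W` to `u ∈ W' ∖ {c, d}` is a connection
inside `W` to `c` (resp. `d`) followed by one inside `W'` from `c` (resp. `d`) to `u`. -/
theorem conn_cross2 {W W' : Set V} {c d : V} {x : Config E}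
    (hx : ∀ e, x e = true → e ∈ within ends W ∨ e ∈ within ends W')
    (hcap : ∀ t, t ∈ W → t ∈ W' → t = c ∨ t = d) {r u : V} (hr : r ∈ W) (hu : u ∈ W')
    (huc : u ≠ c) (hud : u ≠ d) :
    Conn ends x r u ↔ reachW' ends W W' c d x r u := by
  constructor
  · intro h
    rcases reach_of_conn ends hx hcap hr h with ⟨huW, _⟩ | ⟨_, hB⟩
    · rcases hcap u huW hu with h' | h'
      · exact absurd h' huc
      · exact absurd h' hud
    · exact hB
  · intro h
    have hW := withinRestr_le ends W x
    have hW' := withinRestr_le ends W' x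
    unfold reachW' at h
    rcases h with ⟨h1, h2⟩ | ⟨h1, h2⟩
    · exact conn_trans (conn_mono hW h1) (conn_mono hW' h2)
    · exact conn_trans (conn_mono hW h1) (conn_mono hW' h2)

end Sides

/-! ## Far patterns and the exact-pattern indicators -/

section Patterns

open Classical

variable {V : Type*} {E : Type*} (ends : E → Sym2 V)

/-- A far pattern: `(1[c ↔ d], 1[c ↔ u], 1[d ↔ u])`. -/
abbrev FP := Bool × Bool × Bool

/-- The far pattern of a configuration (read on a far-side restriction). -/
noncomputable def fp (c d u : V) (y : Config E) : FP :=
  (decide (Conn ends y c d), decide (Conn ends y c u), decide (Conn ends y d u))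

/-- A pattern is realisable when `c ↔ d` forces `c ↔ u` and `d ↔ u` to agree: the five set
partitions of `{c, d, u}`. -/
def FPok (p : FP) : Prop := p.1 = true → p.2.1 = p.2.2

/-- Every far pattern of a configuration is realisable. -/
lemma fp_ok (c d u : V) (y : Config E) : FPok (fp ends c d u y) := by
  intro h
  simp only [fp, decide_eq_true_eq] at h
  simp only [fp]
  exact decide_eq_decide.mpr ⟨fun h1 => conn_trans (conn_symm h) h1, fun h2 => conn_trans h h2⟩

/-- The exact-pattern indicator. -/
def exact2 (p q : FP) : ℤ := if p = q then 1 else 0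

/-- The indicator is nonnegative. -/
lemma exact2_nonneg (p q : FP) : 0 ≤ exact2 p q := by
  unfold exact2
  split_ifs <;> simp

/-- An unrealisable pattern never matches a realisable one. -/
lemma exact2_of_not_ok {p q : FP} (hp : ¬ FPok p) (hq : FPok q) : exact2 p q = 0 := by
  unfold exact2
  rw [if_neg]
  rintro rfl
  exact hp hq

/-- A pattern triple (one far pattern per copy). -/
abbrev Pat3 := FP × FP × FP

/-- Summing a function against the exact indicators of a pattern triple picks the triple. -/
lemma sum_exact2 (f : Pat3 → ℤ) (q : Pat3) :
    (∑ p : Pat3, exact2 p.1 q.1 * exact2 p.2.1 q.2.1 * exact2 p.2.2 q.2.2 * f p) = f q := by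
  rw [Finset.sum_eq_single q]
  · simp [exact2]
  · intro p _ hpq
    by_cases h1 : p.1 = q.1
    · by_cases h2 : p.2.1 = q.2.1
      · by_cases h3 : p.2.2 = q.2.2
        · exact absurd (Prod.ext h1 (Prod.ext h2 h3)) hpq
        · simp [exact2, h3]
      · simp [exact2, h2]
    · simp [exact2, h1]
  · intro h
    exact absurd (Finset.mem_univ q) h

end Patterns

/-! ## Typed counts of sums and of the far-pattern kernels -/

section Sums

variable {E : Type*} [Fintype E] [DecidableEq E] {R : Type*} [Field R]

/-- The typed count of a finite sum of kernels is the sum of the typed counts. -/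
lemma typedCount_sum {ι : Type*} (s : Finset ι) (F : Finset E) (z : Config E) (τ : E → ℕ)
    (K : ι → Config E → Config E → Config E → R) :
    typedCount F z τ (fun x y w => ∑ i ∈ s, K i x y w) = ∑ i ∈ s, typedCount F z τ (K i) := by
  classical
  induction s using Finset.induction_on with
  | empty =>
    simp only [Finset.sum_empty]
    exact typedCount_zero_kernel F z τ
  | @insert a s ha ih =>
    rw [Finset.sum_insert ha, ← ih, ← typedCount_add']
    exact typedCount_congr' _ _ _ _ _ fun x y w => by rw [Finset.sum_insert ha]

end Sums

section FarCounts

open Classical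

variable {V : Type*} {E : Type*} [Fintype E] [DecidableEq E] {R : Type*} [Field R]
  [LinearOrder R] [IsStrictOrderedRing R]
variable (ends : E → Sym2 V) (c d u : V) (VL : Set V)

/-- The far-side kernel of the exact pattern triple `p`: each copy's far pattern, read on the far
restriction to `VL`, must be the prescribed one. -/
noncomputable def farK (p : Pat3) : Config E → Config E → Config E → R :=
  fun x y w => ((exact2 p.1 (fp ends c d u (withinRestr ends VL x)) *
    exact2 p.2.1 (fp ends c d u (withinRestr ends VL y)) *
    exact2 p.2.2 (fp ends c d u (withinRestr ends VL w)) : ℤ) : R)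

/-- The far-pattern counts are nonnegative. -/
lemma farCount_nonneg (A : Finset E) (z : Config E) (τ : E → ℕ) (p : Pat3) :
    (0 : R) ≤ typedCount A z τ (farK ends c d u VL p) := by
  refine typedCount_nonneg_of_nonneg _ _ _ fun x y w => ?_
  unfold farK
  push_cast
  refine mul_nonneg (mul_nonneg ?_ ?_) ?_ <;> exact_mod_cast exact2_nonneg _ _

omit [LinearOrder R] [IsStrictOrderedRing R] in
/-- The far-pattern count of an unrealisable triple vanishes. -/
lemma farCount_eq_zero_of_not_ok (A : Finset E) (z : Config E) (τ : E → ℕ) (p : Pat3)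
    (hp : ¬ FPok p.1 ∨ ¬ FPok p.2.1 ∨ ¬ FPok p.2.2) :
    typedCount A z τ (farK ends c d u VL p : Config E → Config E → Config E → R) = 0 := by
  rw [← typedCount_zero_kernel A z τ]
  refine typedCount_congr' _ _ _ _ _ fun x y w => ?_
  unfold farK
  rcases hp with hp | hp | hp
  · rw [exact2_of_not_ok hp (fp_ok ends c d u _)]
    simp
  · rw [exact2_of_not_ok hp (fp_ok ends c d u _)]
    simp
  · rw [exact2_of_not_ok hp (fp_ok ends c d u _)]
    simp

omit [LinearOrder R] [IsStrictOrderedRing R] in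
/-- Copy symmetry of the far-pattern counts: the first two copies. -/
lemma farCount_swap12 (A : Finset E) (z : Config E) (τ : E → ℕ) (p : Pat3) :
    typedCount A z τ (farK ends c d u VL (p.2.1, p.1, p.2.2) : Config E → Config E → Config E → R) =
      typedCount A z τ (farK ends c d u VL p) := by
  rw [← typedCount_swap12 A z τ (farK ends c d u VL p)]
  exact typedCount_congr' _ _ _ _ _ fun x y w => by unfold farK; push_cast; ring

omit [LinearOrder R] [IsStrictOrderedRing R] in
/-- Copy symmetry of the far-pattern counts: the last two copies (types in `{1, 2}`). -/
lemma farCount_swap23 (A : Finset E) (z : Config E) (τ : E → ℕ) (hτ : ∀ e ∈ A, τ e = 1 ∨ τ e = 2)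
    (p : Pat3) :
    typedCount A z τ (farK ends c d u VL (p.1, p.2.2, p.2.1) : Config E → Config E → Config E → R) =
      typedCount A z τ (farK ends c d u VL p) := by
  rw [← typedCount_swap23 A z τ hτ (farK ends c d u VL p)]
  exact typedCount_congr' _ _ _ _ _ fun x y w => by unfold farK; push_cast; ring

omit [LinearOrder R] [IsStrictOrderedRing R] in
/-- Copy symmetry of the far-pattern counts: the first and third copies (types in `{1, 2}`). -/
lemma farCount_swap13 (A : Finset E) (z : Config E) (τ : E → ℕ) (hτ : ∀ e ∈ A, τ e = 1 ∨ τ e = 2)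
    (p : Pat3) :
    typedCount A z τ (farK ends c d u VL (p.2.2, p.2.1, p.1) : Config E → Config E → Config E → R) =
      typedCount A z τ (farK ends c d u VL p) := by
  rw [← typedCount_swap13 A z τ hτ (farK ends c d u VL p)]
  exact typedCount_congr' _ _ _ _ _ fun x y w => by unfold farK; push_cast; ring

omit [LinearOrder R] [IsStrictOrderedRing R] in
/-- Copy symmetry of the far-pattern counts: the cyclic shift `(p₁, p₂, p₃) ↦ (p₂, p₃, p₁)`. -/
lemma farCount_cyc (A : Finset E) (z : Config E) (τ : E → ℕ) (hτ : ∀ e ∈ A, τ e = 1 ∨ τ e = 2)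
    (p : Pat3) :
    typedCount A z τ (farK ends c d u VL (p.2.1, p.2.2, p.1) : Config E → Config E → Config E → R) =
      typedCount A z τ (farK ends c d u VL p) := by
  have h1 := typedCount_swap12 A z τ (fun x y w => farK ends c d u VL p w y x : Config E →
    Config E → Config E → R)
  have h2 := typedCount_swap13 A z τ hτ (farK ends c d u VL p : Config E → Config E → Config E → R)
  rw [← h2, ← h1]
  exact typedCount_congr' _ _ _ _ _ fun x y w => by unfold farK; push_cast; ring

omit [LinearOrder R] [IsStrictOrderedRing R] in
/-- Copy symmetry of the far-pattern counts: the cyclic shift `(p₁, p₂, p₃) ↦ (p₃, p₁, p₂)`. -/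
lemma farCount_cyc' (A : Finset E) (z : Config E) (τ : E → ℕ) (hτ : ∀ e ∈ A, τ e = 1 ∨ τ e = 2)
    (p : Pat3) :
    typedCount A z τ (farK ends c d u VL (p.2.2, p.1, p.2.1) : Config E → Config E → Config E → R) =
      typedCount A z τ (farK ends c d u VL p) := by
  have h1 := typedCount_swap12 A z τ (fun x y w => farK ends c d u VL p x w y : Config E →
    Config E → Config E → R)
  have h2 := typedCount_swap23 A z τ hτ (farK ends c d u VL p : Config E → Config E → Config E → R)
  rw [← h2, ← h1]
  exact typedCount_congr' _ _ _ _ _ fun x y w => by unfold farK; push_cast; ring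

end FarCounts

end RootBridge

end CovForm

end Summit.Ventures.PercRepro2
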